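import Summits.RiemannHypothesis.RiemannHypothesis.Theorems.PfPersistenceDefectiveTransportShapeFree
import Summits.RiemannHypothesis.RiemannHypothesis.Theorems.PfPersistenceDefectiveTransportShapeMono
import Summits.RiemannHypothesis.RiemannHypothesis.Theorems.OddSectorOddOneSignedWindowsOddEnergyUpper
import HarnessLib

/-!
# PF persistence campaign (cell `pub-rhpf`, leaf G1.22 TRANSPORT-1, gen 9): the transport kernel of
record, part 9 — SECTOR TWINS of the shape face

Honest framing (verbatim, applies to every line): mechanism/rigidity campaign; no RH claims.

Parts 8/8b/8c placed the shape readings of the parity-free bottom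
`ε = Literature.NumberTheory.LFunctions.weilGroundEnergy` on the floor-rate ladder and proved, for
the EVEN-sector bottom `ε_ev`, that eventual concavity in `a` refutes RH.  The odd column of the
graded table (TRANSPORT.md §17) was left untyped "for want of an odd-sector decay law".  That law IS
in the tree: `OddSector.weilOddGroundEnergy_le_superexp` / `…_eventually_le`
(`Theorems/OddSectorOddOneSignedWindowsOddEnergyUpper.lean`: `ε_od a ≤ C exp (−(π/2) e^{2(a−1)})`
for `a ≥ 3`, hence `ε_od a ≤ δ` eventually for every `δ > 0`, UNCONDITIONALLY).  This part closes
the sector cells, for `ε_od = weilOddGroundEnergy` and `ε_ev = weilEvenGroundEnergy` alike: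

* §1 abstract real analysis (RH-free, [folklore]): a concave function with a floor never drops;
  no-drop + antitone = constant; a strict drop of a function concave against the clock `e^{κ a}`
  sinks linearly in `t = e^{κ a}`, through any floor of rate `κ' < κ`; the clock-to-`a` transfer
  of concavity for an arbitrary antitone `F`;
* §2 the sector bottoms are NOT EVENTUALLY CONSTANT — unconditional (`c > 0` contradicts the
  sector ceiling; `c ≤ 0` is a floor, hence RH (`riemannHypothesis_of_weil{Odd,Even}GroundEnergy_
  bddBelow`), hence `0 ≤ ε ≤ ε_sector = c ≤ 0` at two windows against the strict decrease of `ε`);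
* §3 eventual CONCAVITY of `ε_od` in `a`, or of either sector bottom against any exponential clock,
  REFUTES RH (under RH the sector bottom is `≥ 0`, concave + antitone + floor = constant, §2);
  the sector bottoms are not eventually AFFINE (RH-free: affine = convex ⟹ RH, part 8 §6, and
  concave ⟹ ¬RH);
* §4 for `κ > 1` neither sector bottom is concave against the clock `e^{κ a}` on any half-line —
  UNCONDITIONAL (drop case: linear sinking through the trivial floor `ε_sector ≥ ε ≥ −C e^{κ' a}`;
  no-drop case: §2);
* (part 9b, `PfPersistenceDefectiveTransportShapeSectorClock`) the sector clock dictionaries.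

Every shape clause is a HYPOTHESIS; no reach number is produced; nothing here is a step toward RH.

References: E. Bombieri, Rend. Mat. Acc. Lincei (9) 11 (2000) §4 Thm 5 (monotonicity in the
window); H. Yoshida, Adv. Stud. Pure Math. 21 (1992) Prop. 1 (odd positivity under RH);
A. Connes, C. Consani, H. Moscovici, arXiv:2511.22755 §3; secant inequalities [folklore].
-/

noncomputable section

set_option linter.dupNamespace false

namespace Summit.RiemannHypothesis.RiemannHypothesis.Theorems.PfPersistenceDefectiveTransport

open Set
open _root_.Literature.NumberTheory.LFunctions
open _root_.Summit.RiemannHypothesis.RiemannHypothesis.Theorems.WeilWindowFlowGronwallLeakage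
  (weilGroundEnergy_strictAntiOn)
open _root_.Summit.RiemannHypothesis.RiemannHypothesis.Theorems.PolarPerronFrobenius
  (weilEvenGroundEnergy_le_exp_neg_mul_exp)
open _root_.Summit.RiemannHypothesis.RiemannHypothesis.Theorems.OddSector
  (weilOddGroundEnergy_eventually_le)
open _root_.Summit.RiemannHypothesis.RiemannHypothesis.Theorems.PfPersistenceFloorRateDichotomy
  (riemannHypothesis_of_weilEvenGroundEnergy_bddBelow
    riemannHypothesis_of_weilOddGroundEnergy_bddBelow)

/-! ## §1 Abstract real analysis on a half-line -/

/-- A function concave on `[b, ∞)` with a FLOOR `m ≤ f` never drops strictly: a drop between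
`x < y` gives a secant ceiling of negative slope (part 8 `le_line_of_concaveOn`) that crosses the
floor. RH-free. [folklore] -/
theorem noDrop_of_concaveOn_of_le {f : ℝ → ℝ} {b m : ℝ} (hf : ConcaveOn ℝ (Ici b) f)
    (hm : ∀ t : ℝ, b ≤ t → m ≤ f t) {x y : ℝ} (hx : b ≤ x) (hxy : x < y) : f x ≤ f y := by
  by_contra hlt
  rw [not_le] at hlt
  set c : ℝ := (f x - f y) / (y - x) with hc
  have hcpos : 0 < c := div_pos (by linarith) (by linarith)
  have hym : m ≤ f y := hm y (by linarith)
  set t : ℝ := y + ((f y - m) / c + 1) with ht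
  have hq : 0 ≤ (f y - m) / c := div_nonneg (by linarith) hcpos.le
  have hyt : y ≤ t := by rw [ht]; linarith
  have hceil := le_line_of_concaveOn hf hx hxy hyt
  rw [← hc] at hceil
  have htm : m ≤ f t := hm t (by linarith)
  have e : (t - y) * c = (f y - m) + c := by rw [ht]; field_simp; ring
  linarith

/-- No strict drop + antitone on `[b, ∞)` = constant. RH-free. [folklore] -/
theorem eq_of_noDrop_of_antitoneOn {f : ℝ → ℝ} {b : ℝ} (hanti : AntitoneOn f (Ici b))
    (hflat : ∀ x y : ℝ, b ≤ x → x < y → f x ≤ f y) {t : ℝ} (ht : b ≤ t) : f t = f b := by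
  rcases ht.eq_or_lt with h | h
  · rw [h]
  · exact le_antisymm (hanti self_mem_Ici (mem_Ici.2 ht) ht) (hflat b t le_rfl h)

/-- The clock function `t ↦ F (log t / κ)` of a function `F` antitone on `(0, ∞)` is antitone on
`[t₀, ∞)` for `t₀ > 1` (`κ > 0`). RH-free. [folklore] -/
theorem antitoneOn_clock' {F : ℝ → ℝ} (hF : AntitoneOn F (Ioi 0)) {κ t₀ : ℝ} (hκ : 0 < κ)
    (ht₀ : 1 < t₀) : AntitoneOn (fun t : ℝ => F (Real.log t / κ)) (Ici t₀) := by
  intro x hx y _ hxy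
  have hx1 : 1 < x := ht₀.trans_le hx
  have hx0 : 0 < x := one_pos.trans hx1
  have hlx : 0 < Real.log x / κ := div_pos (Real.log_pos hx1) hκ
  have hle : Real.log x / κ ≤ Real.log y / κ :=
    div_le_div_of_nonneg_right (Real.log_le_log hx0 hxy) hκ.le
  exact hF hlx (hlx.trans_le hle) hle

/-- If the clock function is constant on `[t₁, ∞)` (`t₁ > 0`, `κ > 0`), then `F` is constant on
`[log t₁ / κ, ∞)`. RH-free. [folklore] -/
theorem const_of_clock_const {F : ℝ → ℝ} {κ t₁ : ℝ} (hκ : 0 < κ) (ht₁ : 0 < t₁)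
    (h : ∀ t : ℝ, t₁ ≤ t → F (Real.log t / κ) = F (Real.log t₁ / κ)) :
    ∀ a : ℝ, Real.log t₁ / κ ≤ a → F a = F (Real.log t₁ / κ) := by
  intro a ha
  have hκa : Real.log t₁ ≤ κ * a := by
    have := (div_le_iff₀ hκ).1 ha
    linarith [mul_comm a κ]
  have ht : t₁ ≤ Real.exp (κ * a) := by
    calc t₁ = Real.exp (Real.log t₁) := (Real.exp_log ht₁).symm
      _ ≤ Real.exp (κ * a) := Real.exp_le_exp.2 hκa
  have := h _ ht
  rwa [Real.log_exp, mul_div_cancel_left₀ a hκ.ne'] at this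

/-- **Concavity against a clock ⟹ concavity in `a`, for any `F` antitone on `(0, ∞)`** (part 8c
`concaveOn_of_concaveOn_clock` made abstract): `F a = g (e^{κ a})` with `a ↦ e^{κ a}` convex.
RH-free. [folklore] -/
theorem concaveOn_of_concaveOn_clock' {F : ℝ → ℝ} (hF : AntitoneOn F (Ioi 0)) {κ t₀ : ℝ}
    (hκ : 0 < κ) (ht₀ : 1 < t₀)
    (hconc : ConcaveOn ℝ (Ici t₀) (fun t : ℝ => F (Real.log t / κ))) :
    ConcaveOn ℝ (Ici (Real.log t₀ / κ)) F := by
  have ht₀0 : 0 < t₀ := one_pos.trans ht₀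
  have hφ : ConvexOn ℝ (Ici (Real.log t₀ / κ)) (fun a : ℝ => Real.exp (κ * a)) := by
    have h := (convexOn_exp.comp_linearMap (LinearMap.lsmul ℝ ℝ κ)).subset (subset_univ _)
      (convex_Ici (Real.log t₀ / κ))
    refine h.congr ?_
    intro a _
    simp [smul_eq_mul]
  have hφb : ∀ a ∈ Ici (Real.log t₀ / κ), t₀ ≤ Real.exp (κ * a) := by
    intro a ha
    have h1 : Real.log t₀ ≤ κ * a := by
      have := mem_Ici.1 ha
      rw [div_le_iff₀ hκ] at this
      linarith
    calc t₀ = Real.exp (Real.log t₀) := (Real.exp_log ht₀0).symm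
      _ ≤ Real.exp (κ * a) := Real.exp_le_exp.2 h1
  have hcomp := concaveOn_comp_of_convexOn hconc (antitoneOn_clock' hF hκ ht₀) hφ hφb
  refine hcomp.congr ?_
  intro a _
  show F (Real.log (Real.exp (κ * a)) / κ) = F a
  rw [Real.log_exp, mul_div_cancel_left₀ _ hκ.ne']

/-- **A strict drop of a function concave against the super-clock `e^{κ a}` is incompatible with a
floor of rate `κ' < κ`** (`0 ≤ κ'`; part 8b §1 made abstract): the secant ceiling gives
`F a ≤ E − c e^{κ a}` (`c > 0`), the floor gives `−C e^{κ' a} ≤ F a`, and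
`c e^{κ a} − C e^{κ' a} → ∞`. RH-free. [folklore] -/
theorem false_of_concaveOn_expClock_drop {F : ℝ → ℝ} {κ κ' C t₀ x y : ℝ} (hκ'0 : 0 ≤ κ')
    (hκ : κ' < κ) (hfl : ∀ a : ℝ, 0 < a → -(C * Real.exp (κ' * a)) ≤ F a)
    (hconc : ConcaveOn ℝ (Ici t₀) (fun t : ℝ => F (Real.log t / κ)))
    (ht₀ : 1 ≤ t₀) (hx : t₀ ≤ x) (hxy : x < y)
    (hdrop : F (Real.log y / κ) < F (Real.log x / κ)) : False := by
  have hκ0 : 0 < κ := hκ'0.trans_lt hκ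
  have hκκ' : 0 < κ - κ' := sub_pos.2 hκ
  set g : ℝ → ℝ := fun t : ℝ => F (Real.log t / κ) with hg
  have hdrop' : g y < g x := hdrop
  have hy0 : 0 < y := by linarith
  set c : ℝ := (g x - g y) / (y - x) with hc
  have hcpos : 0 < c := div_pos (by linarith) (by linarith)
  set E : ℝ := g y + c * y with hE
  set a : ℝ := (max C 0 + max E 0 + 1) / (c * (κ - κ')) + Real.log y / κ + 1 with ha
  have hq0 : 0 ≤ (max C 0 + max E 0 + 1) / (c * (κ - κ')) := by positivity
  have hl0 : 0 ≤ Real.log y / κ := div_nonneg (Real.log_nonneg (by linarith)) hκ0.le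
  have ha0 : 0 < a := by rw [ha]; linarith
  have haq : (max C 0 + max E 0 + 1) / (c * (κ - κ')) ≤ a := by rw [ha]; linarith
  have hal : Real.log y / κ ≤ a := by rw [ha]; linarith
  have hκa : Real.log y ≤ κ * a := by
    have := (div_le_iff₀ hκ0).1 hal
    linarith [mul_comm a κ]
  have ht : y ≤ Real.exp (κ * a) := by
    calc y = Real.exp (Real.log y) := (Real.exp_log hy0).symm
      _ ≤ Real.exp (κ * a) := Real.exp_le_exp.2 hκa
  have hga : g (Real.exp (κ * a)) = F a := by
    simp only [hg, Real.log_exp, mul_div_cancel_left₀ a hκ0.ne']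
  have hceil := le_line_of_concaveOn hconc hx hxy ht
  rw [← hc, hga] at hceil
  have hfloor := hfl a ha0
  have hsplit : Real.exp (κ * a) = Real.exp ((κ - κ') * a) * Real.exp (κ' * a) := by
    rw [← Real.exp_add]; ring_nf
  have hlin : (κ - κ') * a + 1 ≤ Real.exp ((κ - κ') * a) := Real.add_one_le_exp _
  have he'1 : 1 ≤ Real.exp (κ' * a) := Real.one_le_exp (by positivity)
  have he'0 : 0 ≤ Real.exp (κ' * a) := (Real.exp_pos _).le
  have hbr : max E 0 + 1 + c ≤ c * ((κ - κ') * a + 1) - C := by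
    have h1 : max C 0 + max E 0 + 1 ≤ c * (κ - κ') * a := by
      have := (div_le_iff₀ (by positivity : 0 < c * (κ - κ'))).1 haq
      linarith [mul_comm a (c * (κ - κ'))]
    have h2 : C ≤ max C 0 := le_max_left _ _
    nlinarith
  have hkey : E < c * Real.exp (κ * a) - C * Real.exp (κ' * a) := by
    have h1 : c * ((κ - κ') * a + 1) * Real.exp (κ' * a) ≤ c * Real.exp (κ * a) := by
      rw [hsplit, ← mul_assoc]
      exact mul_le_mul_of_nonneg_right (mul_le_mul_of_nonneg_left hlin hcpos.le) he'0
    have h2 : (c * ((κ - κ') * a + 1) - C) * 1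
        ≤ (c * ((κ - κ') * a + 1) - C) * Real.exp (κ' * a) :=
      mul_le_mul_of_nonneg_left he'1 (by linarith [le_max_right E 0])
    have h3 : E ≤ max E 0 := le_max_left _ _
    nlinarith
  have : c * Real.exp (κ * a) - C * Real.exp (κ' * a) ≤ E := by
    rw [hE]; nlinarith
  linarith

/-! ## §2 The sector bottoms are not eventually constant (unconditional) -/

/-- Trivial floor of the odd bottom: `−C e^{κ a} ≤ ε a ≤ ε_od a` (`κ > 1`, `a > 0`). RH-free. -/
theorem weilOddGroundEnergy_exp_lower_of_one_lt {κ : ℝ} (hκ : 1 < κ) :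
    ∃ C : ℝ, ∀ a : ℝ, 0 < a → -(C * Real.exp (κ * a)) ≤ weilOddGroundEnergy a := by
  obtain ⟨C, hC⟩ := weilGroundEnergy_exp_lower_of_one_lt hκ
  exact ⟨C, fun a ha => (hC a ha).trans (weilGroundEnergy_le_weilOddGroundEnergy a)⟩

/-- Trivial floor of the even bottom: `−C e^{κ a} ≤ ε a ≤ ε_ev a` (`κ > 1`, `a > 0`). RH-free. -/
theorem weilEvenGroundEnergy_exp_lower_of_one_lt {κ : ℝ} (hκ : 1 < κ) :
    ∃ C : ℝ, ∀ a : ℝ, 0 < a → -(C * Real.exp (κ * a)) ≤ weilEvenGroundEnergy a := by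
  obtain ⟨C, hC⟩ := weilGroundEnergy_exp_lower_of_one_lt hκ
  exact ⟨C, fun a ha => (hC a ha).trans (weilGroundEnergy_le_weilEvenGroundEnergy a)⟩

/-- **The odd bottom is NOT eventually constant** — UNCONDITIONAL.  `ε_od ≡ c` on `[b, ∞)`
(`b > 0`): `c > 0` contradicts `ε_od ≤ c/2` eventually (`OddSector.weilOddGroundEnergy_
eventually_le`); `c ≤ 0` is a floor, so RH (`riemannHypothesis_of_weilOddGroundEnergy_bddBelow`),
so `0 ≤ ε (b+1) < ε b ≤ ε_od b = c ≤ 0`.  RH-free; no RH claim. [folklore] -/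
theorem weilOddGroundEnergy_not_eventually_const {b : ℝ} (hb : 0 < b) (c : ℝ) :
    ¬ ∀ a : ℝ, b ≤ a → weilOddGroundEnergy a = c := by
  intro h
  rcases lt_or_ge 0 c with hc | hc
  · obtain ⟨a₀, ha₀⟩ := Filter.eventually_atTop.1
      (weilOddGroundEnergy_eventually_le (δ := c / 2) (by linarith))
    have h1 := ha₀ (max a₀ b) (le_max_left _ _)
    have h2 := h (max a₀ b) (le_max_right _ _)
    linarith
  · have hRH : _root_.RiemannHypothesis :=
      riemannHypothesis_of_weilOddGroundEnergy_bddBelow (L := c) (a₀ := b)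
        fun a ha => (h a ha).ge
    have h0 : 0 ≤ weilGroundEnergy (b + 1) :=
      weilGroundEnergy_nonneg_of_riemannHypothesis hRH (by linarith)
    have h1 : weilGroundEnergy (b + 1) < weilGroundEnergy b :=
      weilGroundEnergy_strictAntiOn (mem_Ioi.2 hb) (mem_Ioi.2 (by linarith)) (by linarith)
    have h2 : weilGroundEnergy b ≤ c :=
      (weilGroundEnergy_le_weilOddGroundEnergy b).trans (h b le_rfl).le
    linarith

/-- **The even bottom is NOT eventually constant** — UNCONDITIONAL.  `c > 0` contradicts the
theta-quasimode ceiling `ε_ev a ≤ exp (−e^{2a})` (`weilEvenGroundEnergy_le_exp_neg_mul_exp`);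
`c ≤ 0` gives RH (`riemannHypothesis_of_weilEvenGroundEnergy_bddBelow`) and the same contradiction
with the strict decrease of `ε ≤ ε_ev`.  RH-free; no RH claim. [folklore] -/
theorem weilEvenGroundEnergy_not_eventually_const {b : ℝ} (hb : 0 < b) (c : ℝ) :
    ¬ ∀ a : ℝ, b ≤ a → weilEvenGroundEnergy a = c := by
  intro h
  rcases lt_or_ge 0 c with hc | hc
  · obtain ⟨a₀, ha₀⟩ := weilEvenGroundEnergy_le_exp_neg_mul_exp (c := 1)
      (by linarith [Real.pi_gt_three])
    set a : ℝ := max a₀ (max b (|Real.log c| + 1)) with ha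
    have ha1 : a₀ ≤ a := le_max_left _ _
    have ha2 : b ≤ a := (le_max_left _ _).trans (le_max_right _ _)
    have ha3 : |Real.log c| + 1 ≤ a := (le_max_right _ _).trans (le_max_right _ _)
    have h1 : weilEvenGroundEnergy a ≤ Real.exp (-(1 * Real.exp (2 * a))) := ha₀ a ha1
    rw [h a ha2] at h1
    have h2 : -(1 * Real.exp (2 * a)) < Real.log c := by
      have h3 : 2 * a + 1 ≤ Real.exp (2 * a) := Real.add_one_le_exp _
      have h4 : -Real.log c ≤ |Real.log c| := neg_le_abs _
      linarith
    have h5 : Real.exp (-(1 * Real.exp (2 * a))) < c := by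
      calc Real.exp (-(1 * Real.exp (2 * a))) < Real.exp (Real.log c) := Real.exp_lt_exp.2 h2
        _ = c := Real.exp_log hc
    linarith
  · have hRH : _root_.RiemannHypothesis :=
      riemannHypothesis_of_weilEvenGroundEnergy_bddBelow (L := c) (a₀ := b)
        fun a ha => (h a ha).ge
    have h0 : 0 ≤ weilGroundEnergy (b + 1) :=
      weilGroundEnergy_nonneg_of_riemannHypothesis hRH (by linarith)
    have h1 : weilGroundEnergy (b + 1) < weilGroundEnergy b :=
      weilGroundEnergy_strictAntiOn (mem_Ioi.2 hb) (mem_Ioi.2 (by linarith)) (by linarith)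
    have h2 : weilGroundEnergy b ≤ c :=
      (weilGroundEnergy_le_weilEvenGroundEnergy b).trans (h b le_rfl).le
    linarith

/-! ## §3 Eventual concavity in a sector refutes RH; the sector bottoms are not affine -/

/-- **Eventual concavity in `a` of the ODD-sector bottom refutes RH** (odd twin of part 8b
`not_riemannHypothesis_of_concaveOn_even`): under RH `ε_od ≥ 0` (Yoshida,
`weilOddGroundEnergy_nonneg_of_riemannHypothesis`), so the concave antitone `ε_od` is constant on
`[b, ∞)` (§1), which §2 excludes.  RH-free implication; the shape hypothesis is NOT claimed; no RH
claim. [folklore] -/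
theorem not_riemannHypothesis_of_concaveOn_odd {b : ℝ} (hb : 0 < b)
    (hconc : ConcaveOn ℝ (Ici b) weilOddGroundEnergy) : ¬ _root_.RiemannHypothesis := by
  intro hRH
  have hflat : ∀ x y : ℝ, b ≤ x → x < y → weilOddGroundEnergy x ≤ weilOddGroundEnergy y :=
    fun x y hx hxy => noDrop_of_concaveOn_of_le hconc (m := 0)
      (fun t _ => weilOddGroundEnergy_nonneg_of_riemannHypothesis hRH t) hx hxy
  have hanti : AntitoneOn weilOddGroundEnergy (Ici b) :=
    fun x hx y _ hxy => weilOddGroundEnergy_antitone (hb.trans_le hx) hxy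
  exact weilOddGroundEnergy_not_eventually_const hb (weilOddGroundEnergy b)
    fun a ha => eq_of_noDrop_of_antitoneOn hanti hflat ha

/-- **Eventual concavity of `ε_od` against the clock `t = e^{κ a}` refutes RH** (`κ > 0`, any
`t₀`; used on `[max t₀ 2, ∞)`, transferred to `a` by §1). RH-free implication; no RH claim.
[folklore] -/
theorem not_riemannHypothesis_of_concaveOn_expClock_odd {κ : ℝ} (hκ : 0 < κ) (t₀ : ℝ)
    (hconc : ConcaveOn ℝ (Ici t₀) (fun t : ℝ => weilOddGroundEnergy (Real.log t / κ))) :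
    ¬ _root_.RiemannHypothesis := by
  have ht₁ : 1 < max t₀ 2 := lt_of_lt_of_le (by norm_num) (le_max_right _ _)
  have h := concaveOn_of_concaveOn_clock' weilOddGroundEnergy_antitoneOn hκ ht₁
    (hconc.subset (Ici_subset_Ici.2 (le_max_left _ _)) (convex_Ici _))
  exact not_riemannHypothesis_of_concaveOn_odd (div_pos (Real.log_pos ht₁) hκ) h

/-- **Eventual concavity of `ε_ev` against the clock `t = e^{κ a}` refutes RH** (`κ > 0`, any
`t₀`): transfer to `a` (§1) and part 8b `not_riemannHypothesis_of_concaveOn_even`.  RH-free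
implication; no RH claim. [folklore] -/
theorem not_riemannHypothesis_of_concaveOn_expClock_even {κ : ℝ} (hκ : 0 < κ) (t₀ : ℝ)
    (hconc : ConcaveOn ℝ (Ici t₀) (fun t : ℝ => weilEvenGroundEnergy (Real.log t / κ))) :
    ¬ _root_.RiemannHypothesis := by
  have ht₁ : 1 < max t₀ 2 := lt_of_lt_of_le (by norm_num) (le_max_right _ _)
  have h := concaveOn_of_concaveOn_clock' weilEvenGroundEnergy_antitoneOn hκ ht₁
    (hconc.subset (Ici_subset_Ici.2 (le_max_left _ _)) (convex_Ici _))
  exact not_riemannHypothesis_of_concaveOn_even (div_pos (Real.log_pos ht₁) hκ) h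

/-- **The odd bottom is NOT eventually affine in `a`**: affine = convex (⟹ RH, part 8
`riemannHypothesis_of_convexOn_odd`) and concave (⟹ ¬RH).  UNCONDITIONAL, RH-free; no RH claim.
[folklore] -/
theorem not_convexOn_and_concaveOn_odd {b : ℝ} (hb : 0 < b) :
    ¬ (ConvexOn ℝ (Ici b) weilOddGroundEnergy ∧ ConcaveOn ℝ (Ici b) weilOddGroundEnergy) :=
  fun h ↦ not_riemannHypothesis_of_concaveOn_odd hb h.2 (riemannHypothesis_of_convexOn_odd hb h.1)

/-- **The even bottom is NOT eventually affine in `a`** (part 8 `riemannHypothesis_of_convexOn_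
even` + part 8b `not_riemannHypothesis_of_concaveOn_even`).  UNCONDITIONAL, RH-free; no RH claim.
[folklore] -/
theorem not_convexOn_and_concaveOn_even {b : ℝ} (hb : 0 < b) :
    ¬ (ConvexOn ℝ (Ici b) weilEvenGroundEnergy ∧ ConcaveOn ℝ (Ici b) weilEvenGroundEnergy) :=
  fun h ↦ not_riemannHypothesis_of_concaveOn_even hb h.2
    (riemannHypothesis_of_convexOn_even hb h.1)

/-! ## §4 No super-clock concavity in either sector (κ > 1), unconditionally -/

/-- **For `κ > 1` the odd bottom is concave against the clock `t = e^{κ a}` on NO half-line** (odd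
twin of part 8b `not_concaveOn_expClock_of_one_lt`).  On `[max t₀ 2, ∞)`: a strict drop sinks
`ε_od` like `−c e^{κ a}` through the trivial floor of rate `(1+κ)/2` (§1, §2); no strict drop makes
the antitone clock function constant, i.e. `ε_od` eventually constant, excluded by §2.
UNCONDITIONAL, RH-free; no RH claim. [folklore] -/
theorem not_concaveOn_expClock_odd_of_one_lt {κ : ℝ} (hκ : 1 < κ) (t₀ : ℝ) :
    ¬ ConcaveOn ℝ (Ici t₀) (fun t : ℝ => weilOddGroundEnergy (Real.log t / κ)) := by
  intro hconc
  have hκ0 : 0 < κ := by linarith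
  have ht₁ : (2 : ℝ) ≤ max t₀ 2 := le_max_right _ _
  have hconc' : ConcaveOn ℝ (Ici (max t₀ 2)) (fun t : ℝ => weilOddGroundEnergy (Real.log t / κ)) :=
    hconc.subset (Ici_subset_Ici.2 (le_max_left _ _)) (convex_Ici _)
  obtain ⟨C, hC⟩ := weilOddGroundEnergy_exp_lower_of_one_lt (κ := (1 + κ) / 2) (by linarith)
  by_cases hdrop : ∃ x y : ℝ, max t₀ 2 ≤ x ∧ x < y ∧
      weilOddGroundEnergy (Real.log y / κ) < weilOddGroundEnergy (Real.log x / κ)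
  · obtain ⟨x, y, hx, hxy, hlt⟩ := hdrop
    exact false_of_concaveOn_expClock_drop (by linarith) (by linarith) hC hconc' (by linarith)
      hx hxy hlt
  · push Not at hdrop
    have hanti := antitoneOn_clock' weilOddGroundEnergy_antitoneOn hκ0
      (by linarith : (1 : ℝ) < max t₀ 2)
    exact weilOddGroundEnergy_not_eventually_const (div_pos (Real.log_pos (by linarith)) hκ0) _
      (const_of_clock_const (F := weilOddGroundEnergy) hκ0 (by linarith)
        fun t ht => eq_of_noDrop_of_antitoneOn hanti hdrop ht)

/-- **For `κ > 1` the even bottom is concave against the clock `t = e^{κ a}` on NO half-line**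
(even twin; same proof with the even floor and §2).  UNCONDITIONAL, RH-free; no RH claim.
[folklore] -/
theorem not_concaveOn_expClock_even_of_one_lt {κ : ℝ} (hκ : 1 < κ) (t₀ : ℝ) :
    ¬ ConcaveOn ℝ (Ici t₀) (fun t : ℝ => weilEvenGroundEnergy (Real.log t / κ)) := by
  intro hconc
  have hκ0 : 0 < κ := by linarith
  have ht₁ : (2 : ℝ) ≤ max t₀ 2 := le_max_right _ _
  have hconc' : ConcaveOn ℝ (Ici (max t₀ 2))
      (fun t : ℝ => weilEvenGroundEnergy (Real.log t / κ)) :=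
    hconc.subset (Ici_subset_Ici.2 (le_max_left _ _)) (convex_Ici _)
  obtain ⟨C, hC⟩ := weilEvenGroundEnergy_exp_lower_of_one_lt (κ := (1 + κ) / 2) (by linarith)
  by_cases hdrop : ∃ x y : ℝ, max t₀ 2 ≤ x ∧ x < y ∧
      weilEvenGroundEnergy (Real.log y / κ) < weilEvenGroundEnergy (Real.log x / κ)
  · obtain ⟨x, y, hx, hxy, hlt⟩ := hdrop
    exact false_of_concaveOn_expClock_drop (by linarith) (by linarith) hC hconc' (by linarith)
      hx hxy hlt
  · push Not at hdrop
    have hanti := antitoneOn_clock' weilEvenGroundEnergy_antitoneOn hκ0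
      (by linarith : (1 : ℝ) < max t₀ 2)
    exact weilEvenGroundEnergy_not_eventually_const (div_pos (Real.log_pos (by linarith)) hκ0) _
      (const_of_clock_const (F := weilEvenGroundEnergy) hκ0 (by linarith)
        fun t ht => eq_of_noDrop_of_antitoneOn hanti hdrop ht)

end Summit.RiemannHypothesis.RiemannHypothesis.Theorems.PfPersistenceDefectiveTransport

end
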